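import Literature.Computability.AlgebraicComplexity.SmallFormatMatMulRankUpper
import HarnessLib

/-!
# Hensel lifting of matrix multiplication schemes from `ℤ/2` to `ℤ/4`: the first step and its dual certificates

Topic `Literature/Computability/AlgebraicComplexity`; companion of `SmallFormatMatMulRankUpper*.lean` (Brent equations,
`MatMulCellCheck`) and `SmallFormatMatMulRankCharTwo.lean` (record schemes over `𝔽₂`).  Kauers–Moosbauer (ISSAC 2023,
arXiv:2212.01175, §5) decide whether a scheme found over `ℤ₂` «is restricted to ground fields of characteristic two» by
HENSEL LIFTING: a solution of the Brent equations modulo `2^s` is refined to one modulo `2^{s+1}` by an ansatz with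
undetermined coefficients, which «leads to a linear system over `ℤ₂` … If it has no solution, this proves that the
approximation does not admit any refinement to order `s+1`».  This module formalises the first step (`s = 1`) in a form
the kernel can decide on explicit schemes:

* `MatMulHenselLift.LiftsModFour k m n R c1 c2 c3` (§1) — the tables admit integer tables congruent to them modulo `2`
  satisfying every Brent equation of `⟨k,m,n⟩` modulo `4` (the `𝔽₂`-scheme is the termwise reduction of a `ℤ/4`-scheme
  of the same length).
* `MatMulHenselLift.not_lift_of_parity` (§2) — SOUNDNESS OF A DUAL CERTIFICATE (the Farkas alternative of the linear
  system; pure algebra): a list `Λ` of Brent equations such that (i) for every product `t` and every slot position the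
  fibre sums over `Λ` of the complementary coefficient products are even and (ii) `Σ_{e ∈ Λ} (entry_e − rhs_e) ≡ 2 (mod 4)`
  refutes lifting — with `w = c₁ + 2d₁`, `u = c₂ + 2d₂`, `v = c₃ + 2d₃`,
  `(c₁+2d₁)(c₂+2d₂)(c₃+2d₃) ≡ c₁c₂c₃ + 2(d₁c₂c₃ + c₁d₂c₃ + c₁c₂d₃) (mod 4)`, and summed over `Λ` the first-order terms are
  even by (i) (fibrewise regrouping, `two_dvd_sum_of_fibres`), contradicting (ii).
* `MatMulHenselLift.not_lift_of_masks`, `…not_liftsModFour_of_certificate` (§3–4) — conditions (i), (ii) EVALUATED on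
  bitmask rows (`Nat.testBit`; one-hot `^^^` accumulation `slotAcc` for the parities, triple bit-coincidence counts
  `cnt3` for the residual — kernel-accelerated `Nat` arithmetic, a few `10⁵` reduction steps for a certificate of `10³`
  equations; every recursion over `Λ` forces its accumulator (`force`) so that kernel evaluation stays shallow), and
  `agreeAll` tying the bitmasks to the `0/1` tables.
* `Scheme223.liftsModFour` (§5) — non-vacuity: an integral scheme (the catalogue scheme `⟨2,2,3⟩:11`) lifts.

The certificates for the three record `𝔽₂`-schemes of `SmallFormatMatMulRankCharTwo.lean` (`⟨4,4,4⟩:47`, `⟨4,4,5⟩:60`,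
`⟨4,5,5⟩:73` do NOT lift modulo `4`) are in `SmallFormatMatMulRankCharTwoHensel.lean`.  HONEST FRAMING: negative
certificates of a decision procedure for explicit small schemes; nothing here bears on `ω`.

PRIOR FORMALISATION (paragraph added 2026-08-30, after landing).  `BrentHenselLifting.lean` (2026-08-22) formalises the
same lifting step of Kauers–Moosbauer §5 in tensor coordinates (`brent_refine_dvd_iff`, `kauersMoosbauer2023_hensel_step`,
`kauersMoosbauer2023_no_refinement_of_dual`), and `HenselLiftParityObstruction.lean` (2026-08-23) the same parity
obstruction (`HenselLift.IsLift`, `HenselLift.Cert`, `HenselLift.not_eq_sum_triad`) with kernel certificates for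
`⟨4,4,4⟩:47` and `⟨4,4,5⟩:60`; the present module was written without knowledge of them.  The two encodings are proved
EQUIVALENT in `MatMulSchemeHenselLiftBridge.lean` (`MatMulHenselLift.liftsModFour_iff_exists_isLift`), so the library
has one notion of «lifts modulo 4» with two decision procedures; what the table form adds is a kernel-cheap decision
layer over the `MatMulCellCheck` tables (bitmask certificates: `1129` equations at `R = 73` in about `80 s`) and the
non-vacuity lemma `liftsModFour_of_checkCell`.

## References

* M. Kauers, J. Moosbauer, *Flip graphs for matrix multiplication*, ISSAC 2023, arXiv:2212.01175, §5 (Hensel lifting of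
  schemes found over ℤ₂; «none of our more than 100000 schemes of rank 47 for (4,4,4) … can be lifted from ℤ₂ to ℤ₄»).
  [KauersMoosbauer2022FlipGraphs]
* M. J. H. Heule, M. Kauers, M. Seidl, *New ways to multiply 3×3-matrices*, J. Symbolic Comput. 104 (2021), §2 (Brent
  equations). [HeuleKauersSeidl2021]
* J. E. Hopcroft, L. R. Kerr, SIAM J. Appl. Math. 20 (1971); A. Sedoglavic, FMM catalogue, `2x2x3:11`.
  [HopcroftKerr1971] [SedoglavicFMMCatalogue]
-/

open Finset

namespace Literature.Computability.AlgebraicComplexity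

namespace MatMulHenselLift

open MatMulCellCheck

/-! ## 1. Lifting modulo 4; Brent-equation indices; fibre sums -/

/-- **Lifting modulo 4** (the first step of `2`-adic Hensel lifting of a matrix multiplication scheme found over `ℤ₂`,
Kauers–Moosbauer §5).  The integer tables `c1 c2 c3` (a length-`R` scheme for `⟨k,m,n⟩` modulo `2`, layout of
`MatMulCellCheck`: product `t`, flat slot positions `s + n·r`, `μ + m·κ`, `ν + n·μ'`) LIFT MODULO `4` iff there are integer
tables `w, u, v` congruent to them modulo `2` whose triads satisfy every Brent equation of `⟨k,m,n⟩` modulo `4` —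
equivalently, the `𝔽₂`-scheme is the termwise reduction of a `ℤ/4`-scheme of the same length.
[cite: KauersMoosbauer2022FlipGraphs, §5 (Hensel lifting from ℤ₂ to ℤ₄)] -/
def LiftsModFour (k m n R : ℕ) (c1 c2 c3 : List (List ℤ)) : Prop :=
  ∃ w u v : ℕ → ℕ → ℤ,
    (∀ t i, (2 : ℤ) ∣ w t i - tz c1 t i) ∧ (∀ t i, (2 : ℤ) ∣ u t i - tz c2 t i) ∧
    (∀ t i, (2 : ℤ) ∣ v t i - tz c3 t i) ∧
    ∀ r s κ μ μ' ν : ℕ, r < k → s < n → κ < k → μ < m → μ' < m → ν < n →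
      (4 : ℤ) ∣ (∑ t ∈ range R, w t (s + n * r) * u t (μ + m * κ) * v t (ν + n * μ')) - rhs 1 r s κ μ μ' ν

/-- Index `(r, s, κ, μ, μ', ν)` of one Brent equation of `⟨k,m,n⟩`. [cite: HeuleKauersSeidl2021, §2] -/
structure EqIdx where
  /-- output row -/
  r : ℕ
  /-- output column -/
  s : ℕ
  /-- row of `A` -/
  κ : ℕ
  /-- column of `A` -/
  μ : ℕ
  /-- row of `B` -/
  μ' : ℕ
  /-- column of `B` -/
  ν : ℕ

/-- The equation index lies in the format `⟨k,m,n⟩`. [cite: HeuleKauersSeidl2021, §2] -/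
def EqIdx.inRange (k m n : ℕ) (e : EqIdx) : Bool :=
  decide (e.r < k) && decide (e.s < n) && decide (e.κ < k) && decide (e.μ < m) && decide (e.μ' < m) &&
    decide (e.ν < n)

/-- Flat slot-1 position `s + n·r` of an equation. [cite: HeuleKauersSeidl2021, §2] -/
def pa (n : ℕ) (e : EqIdx) : ℕ := e.s + n * e.r

/-- Flat slot-2 position `μ + m·κ` of an equation. [cite: HeuleKauersSeidl2021, §2] -/
def pb (m : ℕ) (e : EqIdx) : ℕ := e.μ + m * e.κ

/-- Flat slot-3 position `ν + n·μ'` of an equation. [cite: HeuleKauersSeidl2021, §2] -/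
def pc (n : ℕ) (e : EqIdx) : ℕ := e.ν + n * e.μ'

/-- Fibre sum over the certificate: `Σ_{e ∈ Λ, a e = i} X e`. [cite: KauersMoosbauer2022FlipGraphs, §5] -/
def fibSum (Λ : List EqIdx) (a : EqIdx → ℕ) (X : EqIdx → ℤ) (i : ℕ) : ℤ :=
  (Λ.map fun e => if a e = i then X e else 0).sum

/-! ## 2. Soundness of fibre-parity certificates (pure algebra) -/

/-- Interchanging a list sum with a `Finset` sum (helper). [cite: HeuleKauersSeidl2021, §2] -/
theorem list_sum_map_finset_sum {α β : Type*} (l : List α) (S : Finset β) (g : β → α → ℤ) :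
    (l.map fun e => ∑ t ∈ S, g t e).sum = ∑ t ∈ S, (l.map (g t)).sum := by
  induction l with
  | nil => simp
  | cons e l ih => simp [ih, Finset.sum_add_distrib]

/-- Additivity of `(l.map ·).sum` (helper). [cite: HeuleKauersSeidl2021, §2] -/
theorem list_sum_map_add {α : Type*} (l : List α) (f g : α → ℤ) :
    (l.map fun e => f e + g e).sum = (l.map f).sum + (l.map g).sum := by
  induction l with
  | nil => simp
  | cons e l ih => simp [ih]; ring

/-- Subtractivity of `(l.map ·).sum` (helper). [cite: HeuleKauersSeidl2021, §2] -/
theorem list_sum_map_sub {α : Type*} (l : List α) (f g : α → ℤ) :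
    (l.map fun e => f e - g e).sum = (l.map f).sum - (l.map g).sum := by
  induction l with
  | nil => simp
  | cons e l ih => simp [ih]; ring

/-- Pulling a constant factor out of `(l.map ·).sum` (helper). [cite: HeuleKauersSeidl2021, §2] -/
theorem list_sum_map_mul_left {α : Type*} (l : List α) (a : ℤ) (f : α → ℤ) :
    (l.map fun e => a * f e).sum = a * (l.map f).sum := by
  induction l with
  | nil => simp
  | cons e l ih => simp [ih]; ring

/-- Fibrewise regrouping: if every fibre sum of `X` is even, so is `Σ_e d (a e) · X e` for ANY integer
weights `d` depending on `e` only through `a e`. [cite: KauersMoosbauer2022FlipGraphs, §5] -/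
theorem two_dvd_sum_of_fibres (Λ : List EqIdx) (N : ℕ) (a : EqIdx → ℕ) (d : ℕ → ℤ) (X : EqIdx → ℤ)
    (ha : ∀ e ∈ Λ, a e < N) (H : ∀ i < N, (2 : ℤ) ∣ fibSum Λ a X i) :
    (2 : ℤ) ∣ (Λ.map fun e => d (a e) * X e).sum := by
  have h1 : (Λ.map fun e => d (a e) * X e) =
      Λ.map fun e => ∑ i ∈ range N, (if a e = i then d i * X e else 0) := by
    refine List.map_congr_left fun e he => ?_
    rw [Finset.sum_ite_eq (range N) (a e) (fun i => d i * X e), if_pos (mem_range.2 (ha e he))]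
  rw [h1, list_sum_map_finset_sum]
  refine Finset.dvd_sum fun i hi => ?_
  have h2 : (Λ.map fun e => if a e = i then d i * X e else 0) =
      Λ.map fun e => d i * (if a e = i then X e else 0) := by
    refine List.map_congr_left fun e _ => ?_
    split_ifs <;> simp
  rw [h2, list_sum_map_mul_left]
  exact (H i (mem_range.1 hi)).mul_left _

/-- **Soundness of the first-order Hensel certificate** (tables as integer-valued functions `T1 T2 T3`).
If `Λ` is a list of Brent equations of `⟨k,m,n⟩` whose fibre parities all vanish (for every product `t < R`)
and whose residual `Σ_Λ (Σ_t T1 T2 T3 − rhs)` is `2 mod 4`, then no tables congruent to `T1, T2, T3` modulo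
`2` satisfy the Brent equations modulo `4`.  Proof: for `w = T1 + 2d₁, u = T2 + 2d₂, v = T3 + 2d₃`, summing
the equations in `Λ` gives `residual + 2·(first-order terms) ≡ 0 (mod 4)`, and the first-order terms are
even by fibrewise regrouping. [cite: KauersMoosbauer2022FlipGraphs, §5] -/
theorem not_lift_of_parity {k m n R : ℕ} (T1 T2 T3 : ℕ → ℕ → ℤ) (Λ : List EqIdx)
    (hR : ∀ e ∈ Λ, e.r < k ∧ e.s < n ∧ e.κ < k ∧ e.μ < m ∧ e.μ' < m ∧ e.ν < n)
    (hp1 : ∀ t < R, ∀ i < k * n, (2 : ℤ) ∣ fibSum Λ (pa n) (fun e => T2 t (pb m e) * T3 t (pc n e)) i)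
    (hp2 : ∀ t < R, ∀ i < k * m, (2 : ℤ) ∣ fibSum Λ (pb m) (fun e => T1 t (pa n e) * T3 t (pc n e)) i)
    (hp3 : ∀ t < R, ∀ i < m * n, (2 : ℤ) ∣ fibSum Λ (pc n) (fun e => T1 t (pa n e) * T2 t (pb m e)) i)
    (hsum : (Λ.map fun e => (∑ t ∈ range R, T1 t (pa n e) * T2 t (pb m e) * T3 t (pc n e)) -
      rhs 1 e.r e.s e.κ e.μ e.μ' e.ν).sum % 4 = 2) :
    ¬ ∃ w u v : ℕ → ℕ → ℤ,
      (∀ t i, (2 : ℤ) ∣ w t i - T1 t i) ∧ (∀ t i, (2 : ℤ) ∣ u t i - T2 t i) ∧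
      (∀ t i, (2 : ℤ) ∣ v t i - T3 t i) ∧
      ∀ r s κ μ μ' ν : ℕ, r < k → s < n → κ < k → μ < m → μ' < m → ν < n →
        (4 : ℤ) ∣ (∑ t ∈ range R, w t (s + n * r) * u t (μ + m * κ) * v t (ν + n * μ')) - rhs 1 r s κ μ μ' ν := by
  rintro ⟨w, u, v, hw, hu, hv, hB⟩
  -- the first-order corrections
  set d1 : ℕ → ℕ → ℤ := fun t i => (w t i - T1 t i) / 2 with hd1
  set d2 : ℕ → ℕ → ℤ := fun t i => (u t i - T2 t i) / 2 with hd2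
  set d3 : ℕ → ℕ → ℤ := fun t i => (v t i - T3 t i) / 2 with hd3
  have hw' : ∀ t i, w t i = T1 t i + 2 * d1 t i := fun t i => by
    have := Int.mul_ediv_cancel' (hw t i); simp only [hd1]; linarith
  have hu' : ∀ t i, u t i = T2 t i + 2 * d2 t i := fun t i => by
    have := Int.mul_ediv_cancel' (hu t i); simp only [hd2]; linarith
  have hv' : ∀ t i, v t i = T3 t i + 2 * d3 t i := fun t i => by
    have := Int.mul_ediv_cancel' (hv t i); simp only [hd3]; linarith
  -- per-equation expansion (exact identity)
  let lin : EqIdx → ℤ := fun e => ∑ t ∈ range R,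
    (d1 t (pa n e) * (T2 t (pb m e) * T3 t (pc n e)) + d2 t (pb m e) * (T1 t (pa n e) * T3 t (pc n e)) +
      d3 t (pc n e) * (T1 t (pa n e) * T2 t (pb m e)))
  let quad : EqIdx → ℤ := fun e => ∑ t ∈ range R,
    (d1 t (pa n e) * d2 t (pb m e) * T3 t (pc n e) + d1 t (pa n e) * T2 t (pb m e) * d3 t (pc n e) +
      T1 t (pa n e) * d2 t (pb m e) * d3 t (pc n e) + 2 * (d1 t (pa n e) * d2 t (pb m e) * d3 t (pc n e)))
  have key : ∀ e, (∑ t ∈ range R, w t (pa n e) * u t (pb m e) * v t (pc n e)) =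
      (∑ t ∈ range R, T1 t (pa n e) * T2 t (pb m e) * T3 t (pc n e)) + 2 * lin e + 4 * quad e := by
    intro e
    simp only [lin, quad, Finset.mul_sum, ← Finset.sum_add_distrib]
    refine Finset.sum_congr rfl fun t _ => ?_
    rw [hw', hu', hv']
    ring
  -- sum the equations of Λ
  have hdiv : (4 : ℤ) ∣ (Λ.map fun e =>
      (∑ t ∈ range R, w t (pa n e) * u t (pb m e) * v t (pc n e)) - rhs 1 e.r e.s e.κ e.μ e.μ' e.ν).sum := by
    refine List.dvd_sum fun x hx => ?_
    obtain ⟨e, he, rfl⟩ := List.mem_map.1 hx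
    obtain ⟨h1, h2, h3, h4, h5, h6⟩ := hR e he
    exact hB e.r e.s e.κ e.μ e.μ' e.ν h1 h2 h3 h4 h5 h6
  have hsplit : (Λ.map fun e =>
      (∑ t ∈ range R, w t (pa n e) * u t (pb m e) * v t (pc n e)) - rhs 1 e.r e.s e.κ e.μ e.μ' e.ν).sum =
      (Λ.map fun e => (∑ t ∈ range R, T1 t (pa n e) * T2 t (pb m e) * T3 t (pc n e)) -
        rhs 1 e.r e.s e.κ e.μ e.μ' e.ν).sum + 2 * (Λ.map lin).sum + 4 * (Λ.map quad).sum := by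
    have hfun : (fun e : EqIdx =>
        (∑ t ∈ range R, w t (pa n e) * u t (pb m e) * v t (pc n e)) - rhs 1 e.r e.s e.κ e.μ e.μ' e.ν) =
        fun e => ((∑ t ∈ range R, T1 t (pa n e) * T2 t (pb m e) * T3 t (pc n e)) -
          rhs 1 e.r e.s e.κ e.μ e.μ' e.ν) + (2 * lin e + 4 * quad e) := by
      funext e; rw [key]; ring
    rw [hfun, list_sum_map_add, list_sum_map_add, list_sum_map_mul_left, list_sum_map_mul_left]
    ring
  -- the first-order terms are even
  have hlin : (2 : ℤ) ∣ (Λ.map lin).sum := by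
    simp only [lin]
    rw [list_sum_map_finset_sum]
    refine Finset.dvd_sum fun t ht => ?_
    have ht' := mem_range.1 ht
    rw [list_sum_map_add, list_sum_map_add]
    refine dvd_add (dvd_add ?_ ?_) ?_
    · exact two_dvd_sum_of_fibres Λ (k * n) (pa n) (d1 t) _
        (fun e he => by obtain ⟨h1, h2, -, -, -, -⟩ := hR e he; show e.s + n * e.r < k * n; nlinarith)
        (hp1 t ht')
    · exact two_dvd_sum_of_fibres Λ (k * m) (pb m) (d2 t) _
        (fun e he => by obtain ⟨-, -, h3, h4, -, -⟩ := hR e he; show e.μ + m * e.κ < k * m; nlinarith)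
        (hp2 t ht')
    · exact two_dvd_sum_of_fibres Λ (m * n) (pc n) (d3 t) _
        (fun e he => by obtain ⟨-, -, -, -, h5, h6⟩ := hR e he; show e.ν + n * e.μ' < m * n; nlinarith)
        (hp3 t ht')
  -- conclude: 4 ∣ residual, contradicting residual ≡ 2 (mod 4)
  rw [hsplit] at hdiv
  obtain ⟨x, hx⟩ := hdiv
  obtain ⟨y, hy⟩ := hlin
  omega

/-! ## 3. Evaluating a certificate on bitmask rows (kernel-friendly) -/

/-- `0/1` value of a Boolean, in `ℤ`. [cite: HeuleKauersSeidl2021, §2] -/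
def bv (b : Bool) : ℤ := bif b then 1 else 0

/-- Entry `i` of a bitmask row, in `ℤ`. [cite: HeuleKauersSeidl2021, §2] -/
def bit (w i : ℕ) : ℤ := bv (w.testBit i)

/-- `bv b * bv b' = bv (b && b')`. [cite: HeuleKauersSeidl2021, §2] -/
theorem bv_mul (b b' : Bool) : bv b * bv b' = bv (b && b') := by
  cases b <;> cases b' <;> simp [bv]

/-- `force x f = f x`; the kernel evaluates `x` to a numeral before entering `f`, which keeps the evaluation of
long accumulations shallow. [cite: HeuleKauersSeidl2021, §2] -/
def force {α : Sort*} (x : ℕ) (f : ℕ → α) : α :=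
  match x with
  | 0 => f 0
  | j + 1 => f (j + 1)

/-- `force x f = f x`. [cite: HeuleKauersSeidl2021, §2] -/
theorem force_eq {α : Sort*} (x : ℕ) (f : ℕ → α) : force x f = f x := by
  cases x <;> rfl

/-- One-hot XOR accumulation: bit `i` of the result records the parity of `#{e ∈ Λ : a e = i, p e}` (plus the
initial accumulator). [cite: KauersMoosbauer2022FlipGraphs, §5] -/
def slotAcc (a : EqIdx → ℕ) (p : EqIdx → Bool) : ℕ → List EqIdx → ℕ
  | acc, [] => acc
  | acc, e :: Λ => force (bif p e then acc ^^^ 2 ^ a e else acc) (fun acc' => slotAcc a p acc' Λ)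

/-- Bit `i` of the one-hot accumulation is clear iff the fibre count over `i` (plus the initial bit) is
even. [cite: KauersMoosbauer2022FlipGraphs, §5] -/
theorem slotAcc_testBit (a : EqIdx → ℕ) (p : EqIdx → Bool) (i : ℕ) (Λ : List EqIdx) :
    ∀ acc : ℕ, ((slotAcc a p acc Λ).testBit i = false ↔
      (2 : ℤ) ∣ fibSum Λ a (fun e => bv (p e)) i + bv (acc.testBit i)) := by
  induction Λ with
  | nil =>
      intro acc
      cases h : acc.testBit i <;> simp [slotAcc, fibSum, bv, h]
  | cons e Λ ih =>
      intro acc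
      simp only [slotAcc, force_eq]
      rw [ih]
      simp only [fibSum, List.map_cons, List.sum_cons]
      cases hp : p e
      · simp [bv]
      · by_cases ha : a e = i
        · subst ha
          simp only [cond_true, Nat.testBit_xor, Nat.testBit_two_pow_self, if_true]
          cases acc.testBit (a e) <;> simp [bv] <;> omega
        · simp only [cond_true, Nat.testBit_xor, Nat.testBit_two_pow_of_ne ha, if_neg ha]
          cases acc.testBit i <;> simp [bv]

/-- A vanishing one-hot accumulation certifies that every fibre count is even.
[cite: KauersMoosbauer2022FlipGraphs, §5] -/
theorem two_dvd_fibSum_of_slotAcc {a : EqIdx → ℕ} {p : EqIdx → Bool} {Λ : List EqIdx}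
    (h : slotAcc a p 0 Λ = 0) (i : ℕ) : (2 : ℤ) ∣ fibSum Λ a (fun e => bv (p e)) i := by
  have h' : (slotAcc a p 0 Λ).testBit i = false := by rw [h]; exact Nat.zero_testBit i
  have := (slotAcc_testBit a p i Λ 0).1 h'
  simpa [bv] using this

/-- The three fibre-parity checks at one product, on bitmask rows `w u v` of the three tables.
[cite: KauersMoosbauer2022FlipGraphs, §5] -/
def parT (m n : ℕ) (Λ : List EqIdx) (w u v : ℕ) : Bool :=
  (slotAcc (pa n) (fun e => u.testBit (pb m e) && v.testBit (pc n e)) 0 Λ == 0) &&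
  ((slotAcc (pb m) (fun e => w.testBit (pa n e) && v.testBit (pc n e)) 0 Λ == 0) &&
  (slotAcc (pc n) (fun e => w.testBit (pa n e) && u.testBit (pb m e)) 0 Λ == 0))

/-- The fibre-parity checks at every product (simultaneous recursion over the three mask lists; `false` on a
length mismatch). [cite: KauersMoosbauer2022FlipGraphs, §5] -/
def parAll (m n : ℕ) (Λ : List EqIdx) : List ℕ → List ℕ → List ℕ → Bool
  | [], [], [] => true
  | w :: W, u :: U, v :: V => parT m n Λ w u v && parAll m n Λ W U V
  | [], [], _ :: _ => false
  | [], _ :: _, [] => false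
  | [], _ :: _, _ :: _ => false
  | _ :: _, [], [] => false
  | _ :: _, [], _ :: _ => false
  | _ :: _, _ :: _, [] => false

/-- What `parAll = true` says product by product. [cite: KauersMoosbauer2022FlipGraphs, §5] -/
theorem parAll_spec (m n : ℕ) (Λ : List EqIdx) :
    ∀ (W U V : List ℕ), parAll m n Λ W U V = true →
      U.length = W.length ∧ V.length = W.length ∧
      ∀ t < W.length, parT m n Λ (W.getD t 0) (U.getD t 0) (V.getD t 0) = true
  | [], [], [], _ => by simp
  | [], [], _ :: _, h => by simp [parAll] at h
  | [], _ :: _, [], h => by simp [parAll] at h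
  | [], _ :: _, _ :: _, h => by simp [parAll] at h
  | _ :: _, [], [], h => by simp [parAll] at h
  | _ :: _, [], _ :: _, h => by simp [parAll] at h
  | _ :: _, _ :: _, [], h => by simp [parAll] at h
  | w :: W, u :: U, v :: V, h => by
      simp only [parAll, Bool.and_eq_true] at h
      obtain ⟨hT, hrest⟩ := h
      obtain ⟨hU, hV, hall⟩ := parAll_spec m n Λ W U V hrest
      refine ⟨by simp [hU], by simp [hV], fun t ht => ?_⟩
      cases t with
      | zero => simpa using hT
      | succ t =>
          simp only [List.getD_cons_succ]
          exact hall t (by simpa using ht)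

/-- `#{t : all three bits set}` along the three mask lists (the value of `entry` on `0/1` tables).
[cite: HeuleKauersSeidl2021, §2] -/
def cnt3 : List ℕ → List ℕ → List ℕ → ℕ → ℕ → ℕ → ℕ
  | w :: W, u :: U, v :: V, a, b, c =>
      (bif (w.testBit a && u.testBit b && v.testBit c) then 1 else 0) + cnt3 W U V a b c
  | _, _, _, _, _, _ => 0

/-- `cnt3` is the triple-product sum of the bit tables. [cite: HeuleKauersSeidl2021, §2] -/
theorem cnt3_spec (a b c : ℕ) : ∀ (W U V : List ℕ), U.length = W.length → V.length = W.length →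
    (cnt3 W U V a b c : ℤ) =
      ∑ t ∈ range W.length, bit (W.getD t 0) a * bit (U.getD t 0) b * bit (V.getD t 0) c
  | [], U, V, hU, hV => by
      cases U with
      | nil => cases V with
        | nil => simp [cnt3]
        | cons _ _ => simp at hV
      | cons _ _ => simp at hU
  | w :: W, U, V, hU, hV => by
      cases U with
      | nil => simp at hU
      | cons u U =>
        cases V with
        | nil => simp at hV
        | cons v V =>
          simp only [List.length_cons, Nat.add_right_cancel_iff] at hU hV
          have ih := cnt3_spec a b c W U V hU hV
          simp only [List.length_cons, Finset.sum_range_succ', List.getD_cons_zero, List.getD_cons_succ, cnt3]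
          rw [← ih]
          simp only [bit]
          cases w.testBit a <;> cases u.testBit b <;> cases v.testBit c <;> simp [bv]
          all_goals omega

/-- Accumulated `Σ_{e ∈ Λ} cnt3` (shallow evaluation). [cite: HeuleKauersSeidl2021, §2] -/
def cntAcc (W U V : List ℕ) (m n : ℕ) : ℕ → List EqIdx → ℕ
  | acc, [] => acc
  | acc, e :: Λ => force (acc + cnt3 W U V (pa n e) (pb m e) (pc n e)) (fun acc' => cntAcc W U V m n acc' Λ)

/-- `cntAcc` is the list sum of `cnt3`. [cite: HeuleKauersSeidl2021, §2] -/
theorem cntAcc_spec (W U V : List ℕ) (m n : ℕ) (Λ : List EqIdx) :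
    ∀ acc : ℕ, (cntAcc W U V m n acc Λ : ℤ) =
      acc + (Λ.map fun e => (cnt3 W U V (pa n e) (pb m e) (pc n e) : ℤ)).sum := by
  induction Λ with
  | nil => intro acc; simp [cntAcc]
  | cons e Λ ih =>
      intro acc
      simp only [cntAcc, force_eq]
      rw [ih]
      push_cast
      simp only [List.map_cons, List.sum_cons]
      ring

/-- Accumulated number of `rhs = 1` ("diagonal") equations in `Λ` (shallow evaluation).
[cite: HeuleKauersSeidl2021, §2] -/
def diagAcc : ℕ → List EqIdx → ℕ
  | acc, [] => acc
  | acc, e :: Λ => force (acc + if e.r = e.κ ∧ e.μ = e.μ' ∧ e.s = e.ν then 1 else 0) (fun acc' => diagAcc acc' Λ)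

/-- `diagAcc` is the list sum of `rhs 1`. [cite: HeuleKauersSeidl2021, §2] -/
theorem diagAcc_spec (Λ : List EqIdx) :
    ∀ acc : ℕ, (diagAcc acc Λ : ℤ) = acc + (Λ.map fun e => rhs 1 e.r e.s e.κ e.μ e.μ' e.ν).sum := by
  induction Λ with
  | nil => intro acc; simp [diagAcc]
  | cons e Λ ih =>
      intro acc
      simp only [diagAcc, force_eq]
      rw [ih]
      simp only [List.map_cons, List.sum_cons, rhs]
      split_ifs <;> push_cast <;> ring

/-- **Soundness of the evaluated certificate.** For bitmask tables `W U V` (`R` products) and a certificate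
`Λ` in range, `parAll = true` and `Σ_Λ cnt3 ≡ Σ_Λ rhs + 2 (mod 4)` refute lifting modulo `4` of the `0/1`
tables `bit W, bit U, bit V`. [cite: KauersMoosbauer2022FlipGraphs, §5] -/
theorem not_lift_of_masks {k m n R : ℕ} (W U V : List ℕ) (Λ : List EqIdx) (hlen : W.length = R)
    (hR : Λ.all (EqIdx.inRange k m n) = true) (hpar : parAll m n Λ W U V = true)
    (hcnt : cntAcc W U V m n 0 Λ % 4 = (diagAcc 0 Λ + 2) % 4) :
    ¬ ∃ w u v : ℕ → ℕ → ℤ,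
      (∀ t i, (2 : ℤ) ∣ w t i - bit (W.getD t 0) i) ∧ (∀ t i, (2 : ℤ) ∣ u t i - bit (U.getD t 0) i) ∧
      (∀ t i, (2 : ℤ) ∣ v t i - bit (V.getD t 0) i) ∧
      ∀ r s κ μ μ' ν : ℕ, r < k → s < n → κ < k → μ < m → μ' < m → ν < n →
        (4 : ℤ) ∣ (∑ t ∈ range R, w t (s + n * r) * u t (μ + m * κ) * v t (ν + n * μ')) - rhs 1 r s κ μ μ' ν := by
  have hR' : ∀ e ∈ Λ, e.r < k ∧ e.s < n ∧ e.κ < k ∧ e.μ < m ∧ e.μ' < m ∧ e.ν < n := by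
    intro e he
    have h := List.all_eq_true.1 hR e he
    simpa [EqIdx.inRange, Bool.and_eq_true, decide_eq_true_eq, and_assoc] using h
  obtain ⟨hU, hV, hall⟩ := parAll_spec m n Λ W U V hpar
  have hall' : ∀ t < R, parT m n Λ (W.getD t 0) (U.getD t 0) (V.getD t 0) = true :=
    fun t ht => hall t (hlen ▸ ht)
  refine not_lift_of_parity (fun t i => bit (W.getD t 0) i) (fun t i => bit (U.getD t 0) i)
    (fun t i => bit (V.getD t 0) i) Λ hR' ?_ ?_ ?_ ?_
  · intro t ht i _
    have hT := hall' t ht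
    simp only [parT, Bool.and_eq_true, beq_iff_eq] at hT
    have hX : (fun e => bit (U.getD t 0) (pb m e) * bit (V.getD t 0) (pc n e)) =
        fun e => bv ((U.getD t 0).testBit (pb m e) && (V.getD t 0).testBit (pc n e)) :=
      funext fun e => bv_mul _ _
    rw [hX]
    exact two_dvd_fibSum_of_slotAcc hT.1 i
  · intro t ht i _
    have hT := hall' t ht
    simp only [parT, Bool.and_eq_true, beq_iff_eq] at hT
    have hX : (fun e => bit (W.getD t 0) (pa n e) * bit (V.getD t 0) (pc n e)) =
        fun e => bv ((W.getD t 0).testBit (pa n e) && (V.getD t 0).testBit (pc n e)) :=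
      funext fun e => bv_mul _ _
    rw [hX]
    exact two_dvd_fibSum_of_slotAcc hT.2.1 i
  · intro t ht i _
    have hT := hall' t ht
    simp only [parT, Bool.and_eq_true, beq_iff_eq] at hT
    have hX : (fun e => bit (W.getD t 0) (pa n e) * bit (U.getD t 0) (pb m e)) =
        fun e => bv ((W.getD t 0).testBit (pa n e) && (U.getD t 0).testBit (pb m e)) :=
      funext fun e => bv_mul _ _
    rw [hX]
    exact two_dvd_fibSum_of_slotAcc hT.2.2 i
  · have e1 : ∀ e ∈ Λ, (∑ t ∈ range R, bit (W.getD t 0) (pa n e) * bit (U.getD t 0) (pb m e) *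
        bit (V.getD t 0) (pc n e)) = (cnt3 W U V (pa n e) (pb m e) (pc n e) : ℤ) := fun e _ => by
      rw [cnt3_spec _ _ _ W U V hU hV, hlen]
    have hs1 := cntAcc_spec W U V m n Λ 0
    have hs2 := diagAcc_spec Λ 0
    rw [list_sum_map_sub, List.map_congr_left e1]
    push_cast at hs1 hs2
    omega

/-! ## 4. Agreement of the vendored `0/1` tables with bitmask rows -/

/-- Row agreement from position `i` on: the entries are `0/1` and equal the bits of `w`, and `w` has no bit
at or beyond the row length. [cite: HeuleKauersSeidl2021, §2] -/
def agreeRow (w : ℕ) : List ℤ → ℕ → Bool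
  | [], i => decide (w < 2 ^ i)
  | x :: xs, i => (x == bit w i) && agreeRow w xs (i + 1)

/-- Table agreement, row by row (`false` on a length mismatch). [cite: HeuleKauersSeidl2021, §2] -/
def agreeAll : List (List ℤ) → List ℕ → Bool
  | [], [] => true
  | row :: rows, w :: ws => agreeRow w row 0 && agreeAll rows ws
  | [], _ :: _ => false
  | _ :: _, [] => false

/-- What `agreeRow = true` says entry by entry (all positions, default `0` beyond the row).
[cite: HeuleKauersSeidl2021, §2] -/
theorem agreeRow_spec (w : ℕ) :
    ∀ (row : List ℤ) (i₀ : ℕ), agreeRow w row i₀ = true → ∀ j, row.getD j 0 = bit w (i₀ + j)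
  | [], i₀, h, j => by
      simp only [agreeRow, decide_eq_true_eq] at h
      have hlt : w < 2 ^ (i₀ + j) :=
        lt_of_lt_of_le h (Nat.pow_le_pow_right (by norm_num) (Nat.le_add_right _ _))
      simp [bit, bv, Nat.testBit_eq_false_of_lt hlt]
  | x :: xs, i₀, h, j => by
      simp only [agreeRow, Bool.and_eq_true, beq_iff_eq] at h
      obtain ⟨hx, hrest⟩ := h
      cases j with
      | zero => simpa using hx
      | succ j =>
          rw [List.getD_cons_succ, agreeRow_spec w xs (i₀ + 1) hrest j]
          congr 1
          omega

/-- What `agreeAll = true` says: `tz c t i = bit (W.getD t 0) i` for ALL `t, i`, and equal lengths.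
[cite: HeuleKauersSeidl2021, §2] -/
theorem agreeAll_spec : ∀ (c : List (List ℤ)) (W : List ℕ), agreeAll c W = true →
    (∀ t i, tz c t i = bit (W.getD t 0) i) ∧ W.length = c.length
  | [], [], _ => ⟨fun t i => by simp [tz, bit, bv], rfl⟩
  | [], _ :: _, h => by simp [agreeAll] at h
  | _ :: _, [], h => by simp [agreeAll] at h
  | row :: rows, w :: ws, h => by
      simp only [agreeAll, Bool.and_eq_true] at h
      obtain ⟨hrow, hrest⟩ := h
      obtain ⟨htz, hlen⟩ := agreeAll_spec rows ws hrest
      refine ⟨fun t i => ?_, by simp [hlen]⟩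
      cases t with
      | zero => simpa [tz] using agreeRow_spec w row 0 hrow i
      | succ t => simpa [tz] using htz t i

/-- **A checked certificate refutes lifting modulo 4.**  Bitmask rows `W U V` agreeing with the tables `c1 c2 c3`, and a
certificate `Λ` in range whose fibre parities vanish (`parAll`) and whose `0/1` residual is `2 (mod 4)` (`cntAcc`,
`diagAcc`) — four `decide`-able conditions — give `¬ LiftsModFour k m n R c1 c2 c3`.
[cite: KauersMoosbauer2022FlipGraphs, §5] -/
theorem not_liftsModFour_of_certificate {k m n R : ℕ} (c1 c2 c3 : List (List ℤ)) (W U V : List ℕ)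
    (Λ : List EqIdx) (h1 : agreeAll c1 W = true) (h2 : agreeAll c2 U = true) (h3 : agreeAll c3 V = true)
    (hlen : W.length = R) (hR : Λ.all (EqIdx.inRange k m n) = true) (hpar : parAll m n Λ W U V = true)
    (hcnt : cntAcc W U V m n 0 Λ % 4 = (diagAcc 0 Λ + 2) % 4) : ¬ LiftsModFour k m n R c1 c2 c3 := by
  intro h
  unfold LiftsModFour at h
  obtain ⟨w, u, v, hw, hu, hv, hB⟩ := h
  have e1 := (agreeAll_spec c1 W h1).1
  have e2 := (agreeAll_spec c2 U h2).1
  have e3 := (agreeAll_spec c3 V h3).1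
  exact not_lift_of_masks W U V Λ hlen hR hpar hcnt
    ⟨w, u, v, fun t i => by rw [← e1]; exact hw t i, fun t i => by rw [← e2]; exact hu t i,
      fun t i => by rw [← e3]; exact hv t i, hB⟩

/-! ## 5. Non-vacuity: an integral scheme lifts (catalogue scheme `⟨2,2,3⟩:11`) -/

/-- `entry` as a `Finset.range` sum. [cite: HeuleKauersSeidl2021, §2] -/
theorem entry_eq_sum (m n R : ℕ) (c1 c2 c3 : List (List ℤ)) (r s κ μ μ' ν : ℕ) :
    entry m n R c1 c2 c3 r s κ μ μ' ν =
      ∑ t ∈ range R, tz c1 t (s + n * r) * tz c2 t (μ + m * κ) * tz c3 t (ν + n * μ') := by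
  rw [entry, List.sum_ofFn]
  exact Fin.sum_univ_eq_sum_range (fun t => tz c1 t (s + n * r) * tz c2 t (μ + m * κ) * tz c3 t (ν + n * μ')) R

/-- An exact integer scheme lifts modulo `4` (by itself): if every output cell of the integer tables checks
(`MatMulCellCheck.checkCell` with `D = 1`), then `LiftsModFour`. [cite: KauersMoosbauer2022FlipGraphs, §5] -/
theorem liftsModFour_of_checkCell {k m n R : ℕ} {c1 c2 c3 : List (List ℤ)}
    (h : ∀ r : Fin k, ∀ s : Fin n, checkCell k m n R 1 c1 c2 c3 r.val s.val = true) :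
    LiftsModFour k m n R c1 c2 c3 := by
  unfold LiftsModFour
  refine ⟨fun t i => tz c1 t i, fun t i => tz c2 t i, fun t i => tz c3 t i,
    fun t i => by simp, fun t i => by simp, fun t i => by simp, ?_⟩
  intro r s κ μ μ' ν hr hs hκ hμ hμ' hν
  have h' := h ⟨r, hr⟩ ⟨s, hs⟩
  simp only [checkCell, List.all_eq_true, List.mem_range, beq_iff_eq] at h'
  have he := h' κ hκ μ hμ μ' hμ' ν hν
  rw [← entry_eq_sum, he, sub_self]
  exact dvd_zero 4

end MatMulHenselLift

namespace Scheme223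

open MatMulCellCheck MatMulHenselLift

set_option maxHeartbeats 20000000 in
/-- The integer tables of the catalogue scheme `⟨2,2,3⟩:11` satisfy the Brent equations exactly (cell checker of
`MatMulCellCheck`, kernel evaluation). [cite: HopcroftKerr1971, main theorem] [cite: SedoglavicFMMCatalogue, 2x2x3] -/
theorem cells : ∀ r : Fin 2, ∀ s : Fin 3, checkCell 2 2 3 11 1 c1 c2 c3 r.val s.val = true := by
  intro r s
  fin_cases r <;> fin_cases s <;> decide +kernel

/-- Non-vacuity of `LiftsModFour`: the INTEGRAL catalogue scheme `⟨2,2,3⟩:11` (reduced modulo `2`) lifts modulo `4`.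
[cite: HopcroftKerr1971, main theorem] [cite: SedoglavicFMMCatalogue, 2x2x3] -/
theorem liftsModFour : LiftsModFour 2 2 3 11 c1 c2 c3 :=
  liftsModFour_of_checkCell cells

end Scheme223

end Literature.Computability.AlgebraicComplexity
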